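import Summits.ValiantsHypothesis.ValiantsHypothesis.Theorems.DefinabilityGapBlockMerging
import HarnessLib

/-!
# DefinabilityGap — MERGE ISOLATION: three disjoint merges, in ideal form

Route `route-ValiantsHypothesis-DefinabilityGap` (decomp-valiant, lens 5: hardness–randomness / PIT axis); width
road of the read-once leaf F4 / W10 (`KIPlantedHittingRO`, stmt-ValiantsHypothesis-23704, aside), on top of
`DefinabilityGapBlockMerging` (`kiWord`, `wordPoly`, `patch`, `word1`, `word2`, `rename_merge₁_bind₁`,
`rename_merge₂_bind₁`, `card_agree_kiWord_le`, `wordPoly_ne_of_apply_ne`, `dprod`). `φ = bind₁ (kiPer m)`,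
`P_c = kiPer m c = wordPoly (kiWord c)`.
ELEMENTARY · INSTRUMENT (y-side = g35's seed-side merge lever of `DefinabilityGapBlockMerging` iterated through a
generic defect calculus and put in IDEAL form — VARIANT of our own lever; the engine of
`DefinabilityGapFourMatchings`, whose z-side near/far dichotomy is the NEW part) · 0 S-currency · closes NO item ·
graphical forms z_a − z_b only; fan-in ≥ 5, non-matching multisets, general affine forms and the leaf regime
w = q^b ≫ m NOT claimed · K1 / stmt-23704 / VP ≠ VNP untouched.

## The generic defect calculus (§1)

For ANY word family `W : block → (𝔽_q → 𝔽_q)` call `d(c) := |differ (W c) (kiWord c)|` the DEFECT of `c`. One merge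
`c ↦ patch (W a) (W b) (W c)` raises the defect of a live label `c ≠ b` from `≤ D` to `≤ 3D + 2`
(`card_differ_patch_le`: the new word differs from `W c` only on `agree (W c) (W b)`, which lies in
`agree (kiWord c) (kiWord b) ∪ differ (W c) (kiWord c) ∪ differ (W b) (kiWord b)`, of size `≤ 2 + D + D`), and two
live labels `u ≠ v` with defects `≤ D` keep DISTINCT word polynomials as soon as `2 + 2D < m²`
(`wordPoly_ne_of_differ_le`). Budget: `D₀ = 0 ↦ 2 ↦ 8 ↦ 26`; `2 + 52 = 54 < 64`, so THREE merges are good for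
`m ≥ 8` (`wordPoly_word3_ne`).

## Three disjoint merges (§2) and ★ the isolation lemma (§3, `kiPer_threeMerge_eq_zero`, `m ≥ 8`)

For three pairwise vertex-disjoint loopless pairs `p_i = (a_i, b_i)` merge `b₁ → a₁`, `b₂ → a₂`, `b₃ → a₃` in turn
(`word3`, `rename_merge₃_bind₁`); the thrice-merged substitution `φ‴` kills `X a_i − X b_i` for all three `i`
(identifications persist under later patches: `word3_b₁`, `word3_b₂`, `word3_b₃`), hence kills the whole IDEAL
`⟨X a₁ − X b₁, X a₂ − X b₂, X a₃ − X b₃⟩` (`bind₁_word3_eq_zero`, `Ideal.span_le` into the kernel); a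
representative map `rep3` (`b_i ↦ a_i`) reduces "the factor `(u, v)` survives" to `rep3 u ≠ rep3 v`, which holds for
every loopless edge other than the three pairs and their reverses (`rep3_ne_rep3`). ★ For ANY `g` in that ideal — e.g.
any sum of terms `β·Δ_{E′}` with some `p_i ∈ E′` — and any finite loopless edge set `E` avoiding the pairs:
`φ(g + α·Δ_E) = 0 ⟹ α = 0` (`0 = σ₃σ₂σ₁ φ(g + αΔ_E) = α·∏_E (nonzero)` in the domain `ℂ[y]`). The four-term
form `coeff_eq_zero_of_threeMerge` (three pairwise disjoint edges `e_j ∈ N_j`, `j = 2,3,4`, isolate `N₁`) is what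
`DefinabilityGapFourMatchings` calls. No irreducibility, no unique factorisation, no rank bound is used.

## Where this sits (HONEST BOUNDARY)

The calculus is uniform in the number `s` of merges (`D_s = 3^s − 1`, good once `m² > 2·3^s`), but a FOURTH
merge is NOT typed here (fan-in 5 would need `s = 4`, `D₄ = 80`, `m ≥ 13`); fan-in ≥ 6 is defeated by two far
K₄-clusters (no single-term isolation, unbounded exclusive support) and needs CLUSTER isolation — the ≤ 3-term
theorems re-proved over bounded-defect word families — idea currency only. General graphical MULTISETS, affine
forms and the leaf regime w = q^b ≫ m are NOT claimed; K1 / stmt-23704 / VP ≠ VNP untouched.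
-/

noncomputable section

open MvPolynomial
open Literature.Computability.AlgebraicComplexity Literature.Computability.MetaComplexity
open Summit.ValiantsHypothesis.ValiantsHypothesis.Theorems.DefinabilityGapAffineRung
open Summit.ValiantsHypothesis.ValiantsHypothesis.Theorems.DefinabilityGapBlockMerging

set_option linter.dupNamespace false

namespace Summit.ValiantsHypothesis.ValiantsHypothesis.Theorems.DefinabilityGapMergeIsolation

variable {m : ℕ}

/-! ## 1. The generic defect calculus -/

/-- **Defect growth under one merge**: if the live labels `c ≠ b` and `b` of a word family `W` have defects `≤ D`,
then after merging `b` into `a` the label `c` has defect `≤ 3D + 2`. [this file] -/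
theorem card_differ_patch_le {W : (Fin 3 → Fin (qOf m)) → Fin (qOf m) → Fin (qOf m)}
    {a b c : Fin 3 → Fin (qOf m)} {D : ℕ} (hcb : c ≠ b) (hc : (differ (W c) (kiWord m c)).card ≤ D)
    (hb : (differ (W b) (kiWord m b)).card ≤ D) :
    (differ (patch (W a) (W b) (W c)) (kiWord m c)).card ≤ 3 * D + 2 := by
  have h1 := Finset.card_le_card (differ_triangle (patch (W a) (W b) (W c)) (W c) (kiWord m c))
  have h2 := Finset.card_le_card (differ_patch_subset (W a) (W b) (W c))
  have h3 := Finset.card_le_card (agree_subset (W c) (kiWord m c) (W b) (kiWord m b))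
  have h4 := Finset.card_union_le (agree (kiWord m c) (kiWord m b) ∪ differ (W c) (kiWord m c))
    (differ (W b) (kiWord m b))
  have h5 := Finset.card_union_le (agree (kiWord m c) (kiWord m b)) (differ (W c) (kiWord m c))
  have h6 := Finset.card_union_le (differ (patch (W a) (W b) (W c)) (W c)) (differ (W c) (kiWord m c))
  have h7 := card_agree_kiWord_le (m := m) hcb
  omega

/-- **Generic goodness**: two distinct labels whose words have defects `≤ D` keep distinct word polynomials once
`2 + 2D < m²` (they agree on `≤ 2 + 2D` positions, so they differ at a READ position). [this file] -/
theorem wordPoly_ne_of_differ_le {w w' : Fin (qOf m) → Fin (qOf m)} {u v : Fin 3 → Fin (qOf m)} {D : ℕ}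
    (h : 2 + D + D < m * m) (huv : u ≠ v) (hu : (differ w (kiWord m u)).card ≤ D)
    (hv : (differ w' (kiWord m v)).card ≤ D) : wordPoly m w ≠ wordPoly m w' := by
  have h1 := Finset.card_le_card (agree_subset w (kiWord m u) w' (kiWord m v))
  have h2 := Finset.card_union_le (agree (kiWord m u) (kiWord m v) ∪ differ w (kiWord m u))
    (differ w' (kiWord m v))
  have h3 := Finset.card_union_le (agree (kiWord m u) (kiWord m v)) (differ w (kiWord m u))
  have h4 := card_agree_kiWord_le (m := m) huv
  have hcard : (Finset.univ.map (permPad (sq_le_qOf m))).card = m * m := by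
    rw [Finset.card_map, Finset.card_univ, Fintype.card_prod, Fintype.card_fin]
  have hlt : (agree w w').card < (Finset.univ.map (permPad (sq_le_qOf m))).card := by rw [hcard]; omega
  obtain ⟨p, hp, hpa⟩ := Finset.exists_mem_notMem_of_card_lt_card hlt
  obtain ⟨jk, -, rfl⟩ := Finset.mem_map.1 hp
  exact wordPoly_ne_of_apply_ne jk fun he => hpa (mem_agree.2 he)

/-! ## 2. Three disjoint merges -/

/-- The thrice-patched curve words (`b₁ → a₁`, then `b₂ → a₂`, then `b₃ → a₃`, each on the previous family).
[this file] -/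
def word3 (m : ℕ) (a₁ b₁ a₂ b₂ a₃ b₃ c : Fin 3 → Fin (qOf m)) : Fin (qOf m) → Fin (qOf m) :=
  patch (word2 m a₁ b₁ a₂ b₂ a₃) (word2 m a₁ b₁ a₂ b₂ b₃) (word2 m a₁ b₁ a₂ b₂ c)

/-- The third merge applied to the twice-merged `φ`. [this file] -/
theorem rename_merge₃_bind₁ (a₁ b₁ a₂ b₂ a₃ b₃ : Fin 3 → Fin (qOf m))
    (D : MvPolynomial (Fin 3 → Fin (qOf m)) ℂ) :
    rename (mergeSub m (word2 m a₁ b₁ a₂ b₂ a₃) (word2 m a₁ b₁ a₂ b₂ b₃))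
        (bind₁ (fun c => wordPoly m (word2 m a₁ b₁ a₂ b₂ c)) D) =
      bind₁ (fun c => wordPoly m (word3 m a₁ b₁ a₂ b₂ a₃ b₃ c)) D := by
  exact rename_mergeSub_bind₁ (word2 m a₁ b₁ a₂ b₂) _ _ D

/-- After the three merges `b₁` and `a₁` carry the same word. [this file] -/
theorem word3_b₁ {a₁ b₁ a₂ b₂ a₃ b₃ : Fin 3 → Fin (qOf m)} :
    word3 m a₁ b₁ a₂ b₂ a₃ b₃ b₁ = word3 m a₁ b₁ a₂ b₂ a₃ b₃ a₁ := by
  unfold word3; rw [word2_b]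

/-- After the three merges `b₂` and `a₂` carry the same word. [this file] -/
theorem word3_b₂ {a₁ b₁ a₂ b₂ a₃ b₃ : Fin 3 → Fin (qOf m)} :
    word3 m a₁ b₁ a₂ b₂ a₃ b₃ b₂ = word3 m a₁ b₁ a₂ b₂ a₃ b₃ a₂ := by
  unfold word3; rw [word2_y]

/-- After the three merges `b₃` and `a₃` carry the same word. [this file] -/
theorem word3_b₃ {a₁ b₁ a₂ b₂ a₃ b₃ : Fin 3 → Fin (qOf m)} :
    word3 m a₁ b₁ a₂ b₂ a₃ b₃ b₃ = word3 m a₁ b₁ a₂ b₂ a₃ b₃ a₃ := by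
  unfold word3; rw [patch_apply_self, patch_apply_left]

/-- Patch budget after three merges: `≤ 26` positions for a live label. [this file] -/
theorem card_differ_word3_le {a₁ b₁ a₂ b₂ a₃ b₃ c : Fin 3 → Fin (qOf m)} (h₁ : c ≠ b₁) (h₂ : c ≠ b₂)
    (h₃ : c ≠ b₃) (h₂₁ : b₂ ≠ b₁) (h₃₁ : b₃ ≠ b₁) (h₃₂ : b₃ ≠ b₂) :
    (differ (word3 m a₁ b₁ a₂ b₂ a₃ b₃ c) (kiWord m c)).card ≤ 26 := by
  unfold word3
  have h := card_differ_patch_le (W := word2 m a₁ b₁ a₂ b₂) (a := a₃) h₃ (card_differ_word2_le h₁ h₂ h₂₁)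
    (card_differ_word2_le h₃₁ h₃₂ h₂₁)
  omega

/-- **Goodness after three merges** (`m ≥ 8`, `2 + 26 + 26 < 64`): distinct live labels keep distinct word
polynomials. [this file] -/
theorem wordPoly_word3_ne (hm : 8 ≤ m) {a₁ b₁ a₂ b₂ a₃ b₃ u v : Fin 3 → Fin (qOf m)} (huv : u ≠ v)
    (hu₁ : u ≠ b₁) (hu₂ : u ≠ b₂) (hu₃ : u ≠ b₃) (hv₁ : v ≠ b₁) (hv₂ : v ≠ b₂) (hv₃ : v ≠ b₃)
    (h₂₁ : b₂ ≠ b₁) (h₃₁ : b₃ ≠ b₁) (h₃₂ : b₃ ≠ b₂) :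
    wordPoly m (word3 m a₁ b₁ a₂ b₂ a₃ b₃ u) ≠ wordPoly m (word3 m a₁ b₁ a₂ b₂ a₃ b₃ v) := by
  have h64 : 8 * 8 ≤ m * m := Nat.mul_le_mul hm hm
  exact wordPoly_ne_of_differ_le (D := 26) (by omega) huv
    (card_differ_word3_le (a₁ := a₁) (a₂ := a₂) (a₃ := a₃) hu₁ hu₂ hu₃ h₂₁ h₃₁ h₃₂)
    (card_differ_word3_le (a₁ := a₁) (a₂ := a₂) (a₃ := a₃) hv₁ hv₂ hv₃ h₂₁ h₃₁ h₃₂)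

/-- The representative of a block after the three merges: `b_i ↦ a_i`, identity elsewhere. [this file] -/
def rep3 (a₁ b₁ a₂ b₂ a₃ b₃ u : Fin 3 → Fin (qOf m)) : Fin 3 → Fin (qOf m) :=
  if u = b₁ then a₁ else if u = b₂ then a₂ else if u = b₃ then a₃ else u

/-- The four cases of the representative map. [this file] -/
theorem rep3_spec (a₁ b₁ a₂ b₂ a₃ b₃ u : Fin 3 → Fin (qOf m)) :
    (u = b₁ ∧ rep3 a₁ b₁ a₂ b₂ a₃ b₃ u = a₁) ∨ (u ≠ b₁ ∧ u = b₂ ∧ rep3 a₁ b₁ a₂ b₂ a₃ b₃ u = a₂) ∨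
      (u ≠ b₁ ∧ u ≠ b₂ ∧ u = b₃ ∧ rep3 a₁ b₁ a₂ b₂ a₃ b₃ u = a₃) ∨
      (u ≠ b₁ ∧ u ≠ b₂ ∧ u ≠ b₃ ∧ rep3 a₁ b₁ a₂ b₂ a₃ b₃ u = u) := by
  unfold rep3
  by_cases h₁ : u = b₁
  · exact Or.inl ⟨h₁, if_pos h₁⟩
  by_cases h₂ : u = b₂
  · exact Or.inr (Or.inl ⟨h₁, h₂, by rw [if_neg h₁, if_pos h₂]⟩)
  by_cases h₃ : u = b₃
  · exact Or.inr (Or.inr (Or.inl ⟨h₁, h₂, h₃, by rw [if_neg h₁, if_neg h₂, if_pos h₃]⟩))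
  · exact Or.inr (Or.inr (Or.inr ⟨h₁, h₂, h₃, by rw [if_neg h₁, if_neg h₂, if_neg h₃]⟩))

/-- Every block carries the thrice-patched word of its representative. [this file] -/
theorem word3_rep3 (a₁ b₁ a₂ b₂ a₃ b₃ u : Fin 3 → Fin (qOf m)) :
    word3 m a₁ b₁ a₂ b₂ a₃ b₃ u = word3 m a₁ b₁ a₂ b₂ a₃ b₃ (rep3 a₁ b₁ a₂ b₂ a₃ b₃ u) := by
  rcases rep3_spec a₁ b₁ a₂ b₂ a₃ b₃ u with ⟨hu, hr⟩ | ⟨-, hu, hr⟩ | ⟨-, -, hu, hr⟩ | ⟨-, -, -, hr⟩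
  · rw [hr, hu]; exact word3_b₁
  · rw [hr, hu]; exact word3_b₂
  · rw [hr, hu]; exact word3_b₃
  · rw [hr]

/-- Representatives are live labels (outside `{b₁, b₂, b₃}`) when the three pairs are loopless and pairwise
vertex-disjoint. [this file] -/
theorem rep3_ne {a₁ b₁ a₂ b₂ a₃ b₃ : Fin 3 → Fin (qOf m)} (hp₁ : a₁ ≠ b₁) (hp₂ : a₂ ≠ b₂) (hp₃ : a₃ ≠ b₃)
    (h₁₂ : a₁ ≠ a₂ ∧ a₁ ≠ b₂ ∧ b₁ ≠ a₂ ∧ b₁ ≠ b₂) (h₁₃ : a₁ ≠ a₃ ∧ a₁ ≠ b₃ ∧ b₁ ≠ a₃ ∧ b₁ ≠ b₃)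
    (h₂₃ : a₂ ≠ a₃ ∧ a₂ ≠ b₃ ∧ b₂ ≠ a₃ ∧ b₂ ≠ b₃) (u : Fin 3 → Fin (qOf m)) :
    rep3 a₁ b₁ a₂ b₂ a₃ b₃ u ≠ b₁ ∧ rep3 a₁ b₁ a₂ b₂ a₃ b₃ u ≠ b₂ ∧ rep3 a₁ b₁ a₂ b₂ a₃ b₃ u ≠ b₃ := by
  rcases rep3_spec a₁ b₁ a₂ b₂ a₃ b₃ u with ⟨-, hr⟩ | ⟨-, -, hr⟩ | ⟨-, -, -, hr⟩ | ⟨h₁, h₂, h₃, hr⟩ <;>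
    rw [hr]
  exacts [⟨hp₁, h₁₂.2.1, h₁₃.2.1⟩, ⟨fun h => h₁₂.2.2.1 h.symm, hp₂, h₂₃.2.1⟩,
    ⟨fun h => h₁₃.2.2.1 h.symm, fun h => h₂₃.2.2.1 h.symm, hp₃⟩, ⟨h₁, h₂, h₃⟩]

/-- Distinct representatives: a loopless edge other than the three pairs (and their reverses) keeps distinct
endpoints after the three merges. [this file] -/
theorem rep3_ne_rep3 {a₁ b₁ a₂ b₂ a₃ b₃ : Fin 3 → Fin (qOf m)} (h₁₂ : a₁ ≠ a₂ ∧ a₁ ≠ b₂ ∧ b₁ ≠ a₂ ∧ b₁ ≠ b₂)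
    (h₁₃ : a₁ ≠ a₃ ∧ a₁ ≠ b₃ ∧ b₁ ≠ a₃ ∧ b₁ ≠ b₃) (h₂₃ : a₂ ≠ a₃ ∧ a₂ ≠ b₃ ∧ b₂ ≠ a₃ ∧ b₂ ≠ b₃)
    {e : (Fin 3 → Fin (qOf m)) × (Fin 3 → Fin (qOf m))} (hl : e.1 ≠ e.2) (n₁ : e ≠ (a₁, b₁))
    (n₁' : e ≠ (b₁, a₁)) (n₂ : e ≠ (a₂, b₂)) (n₂' : e ≠ (b₂, a₂)) (n₃ : e ≠ (a₃, b₃)) (n₃' : e ≠ (b₃, a₃)) :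
    rep3 a₁ b₁ a₂ b₂ a₃ b₃ e.1 ≠ rep3 a₁ b₁ a₂ b₂ a₃ b₃ e.2 := by
  have pr : ∀ {p q : Fin 3 → Fin (qOf m)}, e ≠ (p, q) → e.1 = p → e.2 ≠ q :=
    fun h hp hq => h (Prod.ext hp hq)
  have pr' : ∀ {p q : Fin 3 → Fin (qOf m)}, e ≠ (p, q) → e.2 = q → e.1 ≠ p :=
    fun h hq hp => h (Prod.ext hp hq)
  rcases rep3_spec a₁ b₁ a₂ b₂ a₃ b₃ e.1 with ⟨hu, ru⟩ | ⟨-, hu, ru⟩ | ⟨-, -, hu, ru⟩ | ⟨-, -, -, ru⟩ <;>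
    rcases rep3_spec a₁ b₁ a₂ b₂ a₃ b₃ e.2 with ⟨hv, rv⟩ | ⟨-, hv, rv⟩ | ⟨-, -, hv, rv⟩ | ⟨-, -, -, rv⟩ <;>
    rw [ru, rv]
  exacts [absurd (hu.trans hv.symm) hl, h₁₂.1, h₁₃.1, (pr n₁' hu).symm,
    h₁₂.1.symm, absurd (hu.trans hv.symm) hl, h₂₃.1, (pr n₂' hu).symm,
    h₁₃.1.symm, h₂₃.1.symm, absurd (hu.trans hv.symm) hl, (pr n₃' hu).symm,
    pr' n₁ hv, pr' n₂ hv, pr' n₃ hv, hl]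

/-! ## 3. ★ The isolation lemma -/

/-- The thrice-merged substitution kills the ideal `⟨X a₁ − X b₁, X a₂ − X b₂, X a₃ − X b₃⟩`. [this file] -/
theorem bind₁_word3_eq_zero {a₁ b₁ a₂ b₂ a₃ b₃ : Fin 3 → Fin (qOf m)} {g : MvPolynomial (Fin 3 → Fin (qOf m)) ℂ}
    (hg : g ∈ Ideal.span ({X a₁ - X b₁, X a₂ - X b₂, X a₃ - X b₃} :
      Set (MvPolynomial (Fin 3 → Fin (qOf m)) ℂ))) :
    bind₁ (fun c => wordPoly m (word3 m a₁ b₁ a₂ b₂ a₃ b₃ c)) g = 0 := by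
  have key : Ideal.span ({X a₁ - X b₁, X a₂ - X b₂, X a₃ - X b₃} :
      Set (MvPolynomial (Fin 3 → Fin (qOf m)) ℂ)) ≤
      RingHom.ker (bind₁ (fun c => wordPoly m (word3 m a₁ b₁ a₂ b₂ a₃ b₃ c))) := by
    rw [Ideal.span_le]
    rintro p (rfl | rfl | rfl) <;>
      simp only [SetLike.mem_coe, RingHom.mem_ker, map_sub, bind₁_X_right, word3_b₁, word3_b₂, word3_b₃,
        sub_self]
  exact RingHom.mem_ker.1 (key hg)

/-- The surviving product: every factor of `Δ_E` has distinct thrice-patched endpoints. [this file] -/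
theorem prod_word3_ne_zero (hm : 8 ≤ m) {a₁ b₁ a₂ b₂ a₃ b₃ : Fin 3 → Fin (qOf m)} (hp₁ : a₁ ≠ b₁)
    (hp₂ : a₂ ≠ b₂) (hp₃ : a₃ ≠ b₃) (h₁₂ : a₁ ≠ a₂ ∧ a₁ ≠ b₂ ∧ b₁ ≠ a₂ ∧ b₁ ≠ b₂)
    (h₁₃ : a₁ ≠ a₃ ∧ a₁ ≠ b₃ ∧ b₁ ≠ a₃ ∧ b₁ ≠ b₃) (h₂₃ : a₂ ≠ a₃ ∧ a₂ ≠ b₃ ∧ b₂ ≠ a₃ ∧ b₂ ≠ b₃)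
    {E : Finset ((Fin 3 → Fin (qOf m)) × (Fin 3 → Fin (qOf m)))}
    (hE : ∀ e ∈ E, e.1 ≠ e.2 ∧ e ≠ (a₁, b₁) ∧ e ≠ (b₁, a₁) ∧ e ≠ (a₂, b₂) ∧ e ≠ (b₂, a₂) ∧
      e ≠ (a₃, b₃) ∧ e ≠ (b₃, a₃)) :
    ∏ e ∈ E, (wordPoly m (word3 m a₁ b₁ a₂ b₂ a₃ b₃ e.1) - wordPoly m (word3 m a₁ b₁ a₂ b₂ a₃ b₃ e.2)) ≠ 0 := by
  rw [Finset.prod_ne_zero_iff]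
  intro e he
  obtain ⟨hl, n₁, n₁', n₂, n₂', n₃, n₃'⟩ := hE e he
  rw [sub_ne_zero, word3_rep3 a₁ b₁ a₂ b₂ a₃ b₃ e.1, word3_rep3 a₁ b₁ a₂ b₂ a₃ b₃ e.2]
  obtain ⟨r₁, r₂, r₃⟩ := rep3_ne hp₁ hp₂ hp₃ h₁₂ h₁₃ h₂₃ e.1
  obtain ⟨s₁, s₂, s₃⟩ := rep3_ne hp₁ hp₂ hp₃ h₁₂ h₁₃ h₂₃ e.2
  exact wordPoly_word3_ne hm (rep3_ne_rep3 h₁₂ h₁₃ h₂₃ hl n₁ n₁' n₂ n₂' n₃ n₃') r₁ r₂ r₃ s₁ s₂ s₃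
    h₁₂.2.2.2.symm h₁₃.2.2.2.symm h₂₃.2.2.2.symm

/-- ★ **THE THREE-MERGE ISOLATION LEMMA** (`m ≥ 8`, ideal form): for three loopless, pairwise vertex-disjoint pairs
`(a_i, b_i)`, ANY `g ∈ ⟨X a₁ − X b₁, X a₂ − X b₂, X a₃ − X b₃⟩` and any finite loopless edge set `E` avoiding the
three pairs (both orientations), `φ(g + α·Δ_E) = 0` forces `α = 0`: merging `b₁ → a₁`, `b₂ → a₂`, `b₃ → a₃` kills
`g` and keeps `Δ_E` nonzero. [this file] -/
theorem kiPer_threeMerge_eq_zero (hm : 8 ≤ m) {a₁ b₁ a₂ b₂ a₃ b₃ : Fin 3 → Fin (qOf m)} (hp₁ : a₁ ≠ b₁)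
    (hp₂ : a₂ ≠ b₂) (hp₃ : a₃ ≠ b₃) (h₁₂ : a₁ ≠ a₂ ∧ a₁ ≠ b₂ ∧ b₁ ≠ a₂ ∧ b₁ ≠ b₂)
    (h₁₃ : a₁ ≠ a₃ ∧ a₁ ≠ b₃ ∧ b₁ ≠ a₃ ∧ b₁ ≠ b₃) (h₂₃ : a₂ ≠ a₃ ∧ a₂ ≠ b₃ ∧ b₂ ≠ a₃ ∧ b₂ ≠ b₃)
    {g : MvPolynomial (Fin 3 → Fin (qOf m)) ℂ}
    (hg : g ∈ Ideal.span ({X a₁ - X b₁, X a₂ - X b₂, X a₃ - X b₃} :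
      Set (MvPolynomial (Fin 3 → Fin (qOf m)) ℂ)))
    {E : Finset ((Fin 3 → Fin (qOf m)) × (Fin 3 → Fin (qOf m)))}
    (hE : ∀ e ∈ E, e.1 ≠ e.2 ∧ e ≠ (a₁, b₁) ∧ e ≠ (b₁, a₁) ∧ e ≠ (a₂, b₂) ∧ e ≠ (b₂, a₂) ∧
      e ≠ (a₃, b₃) ∧ e ≠ (b₃, a₃))
    {α : ℂ} (h0 : bind₁ (kiPer m) (g + C α * dprod E) = 0) : α = 0 := by
  have hφ := congrArg (rename (mergeSub m (word2 m a₁ b₁ a₂ b₂ a₃) (word2 m a₁ b₁ a₂ b₂ b₃)))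
    (congrArg (rename (mergeSub m (word1 m a₁ b₁ a₂) (word1 m a₁ b₁ b₂)))
      (congrArg (rename (mergeSub m (kiWord m a₁) (kiWord m b₁))) h0))
  rw [map_zero, map_zero, map_zero, rename_merge₁_bind₁, rename_merge₂_bind₁, rename_merge₃_bind₁,
    map_add, bind₁_word3_eq_zero hg, zero_add, map_mul, bind₁_C_right, bind₁_dprod] at hφ
  exact (mul_eq_zero.1 hφ).elim (fun h => C_eq_zero.1 h) fun h =>
    absurd h (prod_word3_ne_zero hm hp₁ hp₂ hp₃ h₁₂ h₁₃ h₂₃ hE)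

/-- A term `γ·Δ_N` with an edge `e ∈ N` whose difference lies in `s` belongs to the ideal spanned by `s`.
[this file] -/
theorem C_mul_dprod_mem_span {s : Set (MvPolynomial (Fin 3 → Fin (qOf m)) ℂ)}
    {N : Finset ((Fin 3 → Fin (qOf m)) × (Fin 3 → Fin (qOf m)))}
    {e : (Fin 3 → Fin (qOf m)) × (Fin 3 → Fin (qOf m))} (he : e ∈ N) (hs : X e.1 - X e.2 ∈ s) (γ : ℂ) :
    C γ * dprod N ∈ Ideal.span s := by
  have h : dprod N = (X e.1 - X e.2) * ∏ x ∈ N.erase e, (X x.1 - X x.2) :=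
    (Finset.mul_prod_erase N (fun x => (X x.1 - X x.2 : MvPolynomial (Fin 3 → Fin (qOf m)) ℂ)) he).symm
  rw [h]
  exact (Ideal.span s).mul_mem_left _ (Ideal.mul_mem_right _ _ (Ideal.subset_span hs))

/-- **Four-term form**: three pairwise vertex-disjoint oriented edges `(a₁,b₁) ∈ N₂`, `(a₂,b₂) ∈ N₃`,
`(a₃,b₃) ∈ N₄`, none of them (nor a reverse) in the loopless `N₁`, isolate the first term:
`φ(α₁Δ_{N₁} + α₂Δ_{N₂} + α₃Δ_{N₃} + α₄Δ_{N₄}) = 0 ⟹ α₁ = 0` (`m ≥ 8`). [this file] -/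
theorem coeff_eq_zero_of_threeMerge (hm : 8 ≤ m) {a₁ b₁ a₂ b₂ a₃ b₃ : Fin 3 → Fin (qOf m)} (hp₁ : a₁ ≠ b₁)
    (hp₂ : a₂ ≠ b₂) (hp₃ : a₃ ≠ b₃) (h₁₂ : a₁ ≠ a₂ ∧ a₁ ≠ b₂ ∧ b₁ ≠ a₂ ∧ b₁ ≠ b₂)
    (h₁₃ : a₁ ≠ a₃ ∧ a₁ ≠ b₃ ∧ b₁ ≠ a₃ ∧ b₁ ≠ b₃) (h₂₃ : a₂ ≠ a₃ ∧ a₂ ≠ b₃ ∧ b₂ ≠ a₃ ∧ b₂ ≠ b₃)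
    {N₁ N₂ N₃ N₄ : Finset ((Fin 3 → Fin (qOf m)) × (Fin 3 → Fin (qOf m)))} (he₁ : (a₁, b₁) ∈ N₂)
    (he₂ : (a₂, b₂) ∈ N₃) (he₃ : (a₃, b₃) ∈ N₄)
    (hN : ∀ e ∈ N₁, e.1 ≠ e.2 ∧ e ≠ (a₁, b₁) ∧ e ≠ (b₁, a₁) ∧ e ≠ (a₂, b₂) ∧ e ≠ (b₂, a₂) ∧
      e ≠ (a₃, b₃) ∧ e ≠ (b₃, a₃)) {α₁ α₂ α₃ α₄ : ℂ}
    (h0 : bind₁ (kiPer m) (C α₁ * dprod N₁ + C α₂ * dprod N₂ + C α₃ * dprod N₃ + C α₄ * dprod N₄) = 0) :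
    α₁ = 0 := by
  rw [show C α₁ * dprod N₁ + C α₂ * dprod N₂ + C α₃ * dprod N₃ + C α₄ * dprod N₄ =
      C α₂ * dprod N₂ + C α₃ * dprod N₃ + C α₄ * dprod N₄ + C α₁ * dprod N₁ from by ring] at h0
  refine kiPer_threeMerge_eq_zero hm hp₁ hp₂ hp₃ h₁₂ h₁₃ h₂₃ ?_ hN h0
  refine Ideal.add_mem _ (Ideal.add_mem _ ?_ ?_) ?_
  · exact C_mul_dprod_mem_span he₁ (Set.mem_insert _ _) α₂
  · exact C_mul_dprod_mem_span he₂ (Set.mem_insert_of_mem _ (Set.mem_insert _ _)) α₃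
  · exact C_mul_dprod_mem_span he₃ (Set.mem_insert_of_mem _ (Set.mem_insert_of_mem _ (Set.mem_singleton _))) α₄

end Summit.ValiantsHypothesis.ValiantsHypothesis.Theorems.DefinabilityGapMergeIsolation
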